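import Literature.Analysis.FluidPDE.AxisymmetricEuler
import Literature.Analysis.FluidPDE.KNSSRegularityPlanar
import HarnessLib

/-!
# Kiselev–Šverák 2014: double-exponential small-scale creation for 2-D Euler in a DISC, at the
# boundary (named fact) — the printed «what the wall buys» record for the profile zone Z8

A. Kiselev, V. Šverák, *Small scale creation for solutions of the incompressible two-dimensional
Euler equation*, Ann. of Math. **180** (2014) 1205–1220 = arXiv:1310.4799 [KiselevSverak2014]
(held text `paper:arxiv-1310.4799`; chunks p0002–p0004, p0007, p0011 opened).

Printed (§1 **Theorem 1.1**, chunk p0003): "Consider two-dimensional Euler equation on a unit disk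
`D`. There exists a smooth initial data `ω₀` with `‖∇ω₀‖_{L^∞}/‖ω₀‖_{L^∞} > 1` such that the
corresponding solution `ω(x,t)` satisfies
`‖∇ω(x,t)‖_{L^∞}/‖ω₀‖_{L^∞} ≥ (‖∇ω₀‖_{L^∞}/‖ω₀‖_{L^∞})^{c exp(c‖ω₀‖_{L^∞} t)}` for some `c > 0`
and for all `t ≥ 0`." Setting (§1): vorticity form `∂ₜω + (u·∇)ω = 0`, `u = ∇^⊥ ∫_D G_D ω`
(`∇^⊥ = (∂₂, −∂₁)`), no-flow condition `u·n = 0` on `∂D`; the solution is the global smooth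
solution of Wolibner/Hölder/Yudovich, for which the double-exponential UPPER bound
`‖∇ω(t)‖_∞ ≤ (1 + ‖∇ω₀‖)^{C e^{Ct}}`-type is classical (§2) — the theorem shows it is sharp.

The sentences the cell's zone Z8 («Hou–Luo corner analogue WITHOUT boundary») cites from this
source (quoted, not asserted in Lean):
* "The growth in our example happens at the boundary. We do not know if such growth is possible
  in the bulk of the fluid." (§1, p0003; §5, p0011: "The question of whether double exponential
  growth of the vorticity gradient can happen in the bulk of the fluid in periodic or full plane
  case also remains open.")
* "to keep the background scenario stable, one needs symmetry — and odd symmetry bans nonzero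
  perturbation right where the velocity is most capable of producing double exponential growth
  for all times, on the `x₂ = 0` separatrix … Our observation is that one can use the boundary to
  avoid dealing with the first issue" (§1, p0004) — the mechanism-level statement of what the
  wall buys over a mirror line: vorticity may be NON-ZERO on a wall, but must VANISH on an odd
  symmetry axis (3-D analogue: `LuoHou2014.initialU1` is maximal AT the wall `r = 1`, while any
  `z`-odd boundary-free datum such as `Hou2022.initialU1` vanishes on the mirror plane `z = 0`).
* "The example … has been inspired by numerical simulations of Tom Hou and Guo Luo … at a
  boundary. Our construction here implies that double exponential in time growth in derivatives
  of vorticity is certainly possible in 3D Euler; one does not need any growth in the amplitude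
  of vorticity to achieve that. Any further growth in the 3D case must come from more complex
  nonlinear interactions, and by the Kato–Beale–Majda criterion must involve infinite growth of
  vorticity." (§5, p0011.)
* Key Lemma 3.1 (p0007): near the boundary hyperbolic point, in the sector `0 ≤ φ ≤ π/2 − γ`,
  `u₁(x,t) = −(4/π) x₁ ∫_{Q(x)} y₁y₂|y|⁻⁴ ω(y,t) dy + x₁B₁`, `|B₁| ≤ C(γ)‖ω₀‖_∞` (the law behind
  the 1-D boundary models of Choi–Kiselev–Yao and of Hou–Luo / CHKLSY; not typed here — the
  tree's 1-D models are `HouLuoModelSelfSimilarBlowup.lean` and the files of profile-lit g6).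

## Contents

* `unitDisc` — the open unit disc of `ℝ²` as an `Opens` (outward normal `x ↦ x` on `{‖x‖ = 1}`).
* `KiselevSverak2014_doubleExponentialGrowth` — NAMED FACT (net debt +1): Theorem 1.1 rendered
  with the tree's Euler-with-boundary class `IsClassicalEulerOnDomain (Ici 0) unitDisc id 0 u p`
  (velocity and pressure `C¹` up to the boundary, Euler inside, `u·x = 0` on the circle), slices
  smooth in the open disc, the scalar vorticity `curl2 (u t)` (`KNSSRegularityPlanar.lean`), and
  SUP NORMS OVER THE OPEN DISC written junk-free: `A₀ = ‖ω₀‖_∞`, `B₀ = ‖∇ω₀‖_∞` as least upper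
  bounds (`IsLUB`) of `|curl2 (u 0)|` and `‖D(curl2 (u 0))‖` over the disc, the hypothesis
  `‖∇ω₀‖_∞/‖ω₀‖_∞ > 1` as `0 < A₀ < B₀`, and the conclusion "`‖∇ω(t)‖_{L^∞(D)} ≥ A₀(B₀/A₀)^{c e^{cA₀t}}`"
  as "every `M` below that number is exceeded by `‖D(curl2 (u t))(x)‖` at some interior point"
  (equivalent for a quantity continuous up to the boundary; derivatives are only ever taken at
  interior points, where the slices are genuinely differentiable).
* PROVED (small API): `mem_unitDisc`, `frontier_unitDisc` (the boundary is the unit circle, where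
  the slip condition of the structure is imposed), and `KiselevSverak2014_doubleExponentialGrowth
  .exists_gradient_gt` (for every `t ≥ 0` the vorticity gradient exceeds `A₀(B₀/A₀)^{c e^{cA₀t}} − ε`
  somewhere in the disc — the citable reading).

WHAT THIS IS NOT: not Navier–Stokes and not 3-D: a 2-D inviscid theorem WITH a wall, recorded so
that the Z8 sheet can cite, by name, what is PROVED with a boundary (this fact; in 3-D with a
wall: `ChenHou2022_axisymmetricEulerBlowup`) against what is printed as OPEN without one (the
bulk question above; in 3-D: Hou's interior scenario, `Hou2022.initialU1`, numerics only).

## References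

* A. Kiselev, V. Šverák, Ann. of Math. 180 (2014) 1205–1220, doi:10.4007/annals.2014.180.3.9 =
  arXiv:1310.4799: abstract (p0002), §1 Thm 1.1 and discussion (p0003–p0004), §3 Lemma 3.1
  (p0007), §5 (p0011). [`KiselevSverak2014`]
* V. I. Yudovich, *The flow of a perfect, incompressible liquid through a given region* (1962);
  W. Wolibner (1933) — global smooth solutions of 2-D Euler in bounded domains (the "corresponding
  solution" of the theorem), as quoted in §1.
-/

noncomputable section

open MeasureTheory Set Function Filter TopologicalSpace Metric
open _root_.Topology
open scoped ContDiff NNReal RealInnerProductSpace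

namespace Literature.Analysis.FluidPDE

/-! ### The disc -/

/-- The open unit disc `D = {x ∈ ℝ² : ‖x‖ < 1}` of Kiselev–Šverák's Theorem 1.1 (they centre it at
`(0,1)`; the centre is immaterial), as an open set of `ℝ²`; its outward unit normal on
`∂D = {‖x‖ = 1}` is `x ↦ x`. [cite: KiselevSverak2014, §1 Thm 1.1 and §3 (arXiv:1310.4799 p0003, p0007)] -/
def unitDisc : Opens (EuclideanSpace ℝ (Fin 2)) :=
  ⟨ball 0 1, isOpen_ball⟩

/-- Membership in the unit disc. [cite: KiselevSverak2014, §1 (arXiv:1310.4799 p0003)] -/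
@[simp] theorem mem_unitDisc {x : EuclideanSpace ℝ (Fin 2)} : x ∈ unitDisc ↔ ‖x‖ < 1 := by
  simp [unitDisc]

/-- The boundary of the unit disc is the unit circle (where the no-flow condition `u · n = 0` of
§1 is imposed). [cite: KiselevSverak2014, §1 ("we impose a no flow condition at the boundary", arXiv:1310.4799 p0003)] -/
theorem frontier_unitDisc :
    frontier (unitDisc : Set (EuclideanSpace ℝ (Fin 2))) = sphere 0 1 := by
  change frontier (ball (0 : EuclideanSpace ℝ (Fin 2)) 1) = sphere 0 1
  exact frontier_ball 0 one_ne_zero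

/-! ### The named fact -/

/-- **Kiselev–Šverák 2014, Theorem 1.1** (double-exponential growth of the vorticity gradient for
2-D Euler in a disc, for all times, at the boundary). Printed: "Consider two-dimensional Euler
equation on a unit disk `D`. There exists a smooth initial data `ω₀` with
`‖∇ω₀‖_{L^∞}/‖ω₀‖_{L^∞} > 1` such that the corresponding solution `ω(x,t)` satisfies
`‖∇ω(x,t)‖_{L^∞}/‖ω₀‖_{L^∞} ≥ (‖∇ω₀‖_{L^∞}/‖ω₀‖_{L^∞})^{c exp(c‖ω₀‖_{L^∞}t)}` for some `c > 0` and
for all `t ≥ 0`." **Rendering** (module docstring): there are `c > 0`, a classical solution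
`(u, p)` of the Euler equations (`f = 0`) in the unit disc on `[0, ∞)` with the no-flow condition
on the circle (`IsClassicalEulerOnDomain (Ici 0) unitDisc id 0 u p`), with slices smooth in the
open disc, and reals `A₀ = sup_D |ω₀|`, `B₀ = sup_D ‖∇ω₀‖` (least upper bounds over the open disc
of the scalar vorticity `ω₀ = curl2 (u 0)` and of its derivative) with `0 < A₀ < B₀`, such that
for every `t ≥ 0`, `sup_D ‖∇ω(t)‖ ≥ A₀ (B₀/A₀)^{c e^{c A₀ t}}` in the junk-free form "every
smaller number is exceeded at an interior point".
[cite: KiselevSverak2014, §1 Theorem 1.1 (arXiv:1310.4799 p0003); proof §§3–4; §5 ("the growth in our example happens at the boundary", p0011)] -/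
def KiselevSverak2014_doubleExponentialGrowth : Prop :=
  ∃ c : ℝ, 0 < c ∧
    ∃ (u : ℝ → EuclideanSpace ℝ (Fin 2) → EuclideanSpace ℝ (Fin 2))
      (p : ℝ → EuclideanSpace ℝ (Fin 2) → ℝ) (A₀ B₀ : ℝ),
      FluidPDE.IsClassicalEulerOnDomain (Ici 0) unitDisc (fun x => x) 0 u p ∧
      (∀ t ∈ Ici (0 : ℝ), ContDiffOn ℝ ∞ (u t) (ball 0 1)) ∧
      IsLUB ((fun x => |curl2 (u 0) x|) '' ball 0 1) A₀ ∧
      IsLUB ((fun x => ‖fderiv ℝ (curl2 (u 0)) x‖) '' ball 0 1) B₀ ∧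
      0 < A₀ ∧ A₀ < B₀ ∧
      ∀ t : ℝ, 0 ≤ t → ∀ M : ℝ, M < A₀ * (B₀ / A₀) ^ (c * Real.exp (c * A₀ * t)) →
        ∃ x ∈ ball (0 : EuclideanSpace ℝ (Fin 2)) 1, M < ‖fderiv ℝ (curl2 (u t)) x‖

/-! ### Proved reading -/

/-- Under the fact: for every `t ≥ 0` and `ε > 0` the vorticity gradient of Kiselev–Šverák's
solution exceeds `A₀(B₀/A₀)^{c e^{cA₀t}} − ε` at some point of the open disc — the citable
`ε`-form of "`‖∇ω(t)‖_{L^∞(D)} ≥ ‖ω₀‖_∞ (‖∇ω₀‖_∞/‖ω₀‖_∞)^{c exp(c‖ω₀‖_∞ t)}`", together with the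
base `B₀/A₀ > 1` that makes the right-hand side double-exponentially large.
[cite: KiselevSverak2014, §1 Theorem 1.1 (arXiv:1310.4799 p0003)] -/
theorem KiselevSverak2014_doubleExponentialGrowth.exists_gradient_gt
    (h : KiselevSverak2014_doubleExponentialGrowth) :
    ∃ c : ℝ, 0 < c ∧
      ∃ (u : ℝ → EuclideanSpace ℝ (Fin 2) → EuclideanSpace ℝ (Fin 2)) (A₀ B₀ : ℝ),
        1 < B₀ / A₀ ∧ 0 < A₀ ∧
        ∀ t : ℝ, 0 ≤ t → ∀ ε : ℝ, 0 < ε →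
          ∃ x ∈ ball (0 : EuclideanSpace ℝ (Fin 2)) 1,
            A₀ * (B₀ / A₀) ^ (c * Real.exp (c * A₀ * t)) - ε < ‖fderiv ℝ (curl2 (u t)) x‖ := by
  obtain ⟨c, hc, u, p, A₀, B₀, -, -, -, -, hA, hAB, hgrow⟩ := h
  refine ⟨c, hc, u, A₀, B₀, (one_lt_div hA).mpr hAB, hA, fun t ht ε hε => ?_⟩
  exact hgrow t ht _ (sub_lt_self _ hε)

end Literature.Analysis.FluidPDE

end
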